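import Literature.Geometry.Kaehler.LinearHomotopyOperator
import Literature.Geometry.Kaehler.ManifoldFormsChart
import Literature.Topology.FourManifolds.SmoothOrientationProd
import HarnessLib

/-!
# The fibre primitive of a form on `N × ℝ` (relative Poincaré lemma along the `ℝ`-factor)

Continuation of `LinearHomotopyOperator.lean` / `LinearHomotopyOperatorLocal.lean` (the flat
homotopy operator `K = linHomOperator Q` of `H_σ = id - (1 - σ) Q`) to forms on a product
manifold `N × ℝ` (`N` modelled on `ℝᵐ`, model `(𝓡 m).prod 𝓘(ℝ, ℝ)`, the convention of the
origami collar files), with `Q (a, s) = (0, s)` the vertical part: the **fibre primitive**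

  `fibrePrimitive η (n, t) = ∫₀¹ H_σ^* (ι_{(0,t)} η (n, σ t)) dσ`

of a `(k+1)`-form `η` (the tangent spaces at `(n, t)` and `(n, σ t)` are identified through the
common chart frame `chart n × id` — `tangentCoordChange_prod_real`).  This file proves:

* `fibrePrimitive_eq_smul` — the explicit factor `t`:
  `fibrePrimitive η (n, t) = t • ∫₀¹ H_σ^* (ι_{(0,1)} η (n, σ t)) dσ`, so it vanishes on `N × {0}`;
* `inChart_fibrePrimitive` — **in the product chart at `x₀` the fibre primitive IS the flat
  operator of the chart representative**: `(fibrePrimitive η).inChart x₀ = K (η.inChart x₀)` on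
  the chart target (the coordinate change `τ × id` is constant along the fibres, fixes `(0, s)`
  and commutes with `H_σ`).

The smoothness of `fibrePrimitive η` and `d (fibrePrimitive η) = η` for closed `η` vanishing on
`N × {0}` then follow from the flat file (`contDiffOn_linHomOperator`,
`extDeriv_linHomOperator_of_closed_of_mapsTo`) in the sequel.  Used for the Moser argument near
the fold of an origami manifold (Cannas da Silva–Guillemin–Woodward 2000, proof of Thm. 1;
McDuff–Salamon 2017, Lemma 3.2.1).

## References

* D. McDuff, D. Salamon, *Introduction to Symplectic Topology*, 3rd ed. (2017), §3.2.
  [McDuffSalamon2017]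
* R. Bott, L. W. Tu, *Differential Forms in Algebraic Topology* (1982), §I.4. [BottTu1982Forms]
-/

noncomputable section

open scoped Topology ContDiff Manifold
open Set Filter MeasureTheory intervalIntegral ContinuousAlternatingMap
open Literature.Topology.FourManifolds

namespace Literature.Geometry.Kaehler

variable {m : ℕ} {F : Type*} [NormedAddCommGroup F] [NormedSpace ℝ F] {k : ℕ}

/-- The vertical part `Q (a, s) = (0, s)` of the model space `ℝᵐ × ℝ`. [folklore] -/
def vertQ (m : ℕ) : (EuclideanSpace ℝ (Fin m) × ℝ) →L[ℝ] (EuclideanSpace ℝ (Fin m) × ℝ) :=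
  (ContinuousLinearMap.inr ℝ (EuclideanSpace ℝ (Fin m)) ℝ).comp
    (ContinuousLinearMap.snd ℝ (EuclideanSpace ℝ (Fin m)) ℝ)

/-- `Q (a, s) = (0, s)`. [folklore] -/
@[simp] theorem vertQ_apply (x : EuclideanSpace ℝ (Fin m) × ℝ) : vertQ m x = ((0 : _), x.2) := rfl

/-- `H_σ (a, s) = (a, σ s)`. [folklore] -/
theorem linHom_vertQ_apply (σ : ℝ) (x : EuclideanSpace ℝ (Fin m) × ℝ) :
    linHom (vertQ m) σ x = (x.1, σ * x.2) :=
  linHom_inr_comp_snd_apply σ x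

/-- `H_σ` commutes with maps of the form `T × id`. [folklore] -/
theorem linHom_vertQ_comp_prodMap (σ : ℝ)
    (T : EuclideanSpace ℝ (Fin m) →L[ℝ] EuclideanSpace ℝ (Fin m)) :
    (linHom (vertQ m) σ).comp (T.prodMap (ContinuousLinearMap.id ℝ ℝ)) =
      (T.prodMap (ContinuousLinearMap.id ℝ ℝ)).comp (linHom (vertQ m) σ) := by
  ext x <;> simp [linHom_vertQ_apply]

variable {N : Type*} [TopologicalSpace N] [ChartedSpace (EuclideanSpace ℝ (Fin m)) N]

/-- **The fibre primitive** of a `(k+1)`-form on `N × ℝ`: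
`(n, t) ↦ ∫₀¹ H_σ^* (ι_{(0,t)} η (n, σ t)) dσ`, the flat operator `linHomOperator (vertQ m)`
applied to the fibre `s ↦ η (n, s)` at `(0, t)`. [cite: McDuffSalamon2017, Lemma 3.2.1] -/
def fibrePrimitive (η : MForm ((𝓡 m).prod 𝓘(ℝ, ℝ)) (N × ℝ) F (k + 1)) :
    MForm ((𝓡 m).prod 𝓘(ℝ, ℝ)) (N × ℝ) F k := fun x ↦
  linHomOperator (vertQ m)
    (fun p : EuclideanSpace ℝ (Fin m) × ℝ ↦
      (η (x.1, p.2) : (EuclideanSpace ℝ (Fin m) × ℝ) [⋀^Fin (k + 1)]→L[ℝ] F))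
    (((0 : EuclideanSpace ℝ (Fin m)), x.2) : EuclideanSpace ℝ (Fin m) × ℝ)

/-- The fibre primitive as an explicit integral. [folklore] -/
theorem fibrePrimitive_apply (η : MForm ((𝓡 m).prod 𝓘(ℝ, ℝ)) (N × ℝ) F (k + 1)) (x : N × ℝ) :
    fibrePrimitive η x = ∫ σ in (0 : ℝ)..1,
      (((η (x.1, σ * x.2) : (EuclideanSpace ℝ (Fin m) × ℝ) [⋀^Fin (k + 1)]→L[ℝ] F)).curryLeft
        (((0 : EuclideanSpace ℝ (Fin m)), x.2) : EuclideanSpace ℝ (Fin m) × ℝ)).compContinuousLinearMap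
        (linHom (vertQ m) σ) := by
  simp only [fibrePrimitive, linHomOperator, linHomIntegrand, vertQ_apply]
  refine congrArg (fun f : ℝ → (EuclideanSpace ℝ (Fin m) × ℝ) [⋀^Fin k]→L[ℝ] F ↦
    ∫ σ in (0 : ℝ)..1, f σ) (funext fun σ ↦ ?_)
  have gen : ∀ (p q : N × ℝ), p = q →
      (((η p : (EuclideanSpace ℝ (Fin m) × ℝ) [⋀^Fin (k + 1)]→L[ℝ] F)).curryLeft
        (((0 : EuclideanSpace ℝ (Fin m)), x.2) : EuclideanSpace ℝ (Fin m) × ℝ)).compContinuousLinearMap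
        (linHom (vertQ m) σ) =
      (((η q : (EuclideanSpace ℝ (Fin m) × ℝ) [⋀^Fin (k + 1)]→L[ℝ] F)).curryLeft
        (((0 : EuclideanSpace ℝ (Fin m)), x.2) : EuclideanSpace ℝ (Fin m) × ℝ)).compContinuousLinearMap
        (linHom (vertQ m) σ) := by
    intro p q h
    subst h
    rfl
  refine gen _ _ ?_
  rw [linHom_vertQ_apply]

/-- **The explicit factor `t`**: `fibrePrimitive η (n, t) = t • ∫₀¹ H_σ^* (ι_{(0,1)} η (n, σt)) dσ`;
in particular the fibre primitive vanishes on `N × {0}`. [cite: McDuffSalamon2017, Lemma 3.2.1] -/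
theorem fibrePrimitive_eq_smul (η : MForm ((𝓡 m).prod 𝓘(ℝ, ℝ)) (N × ℝ) F (k + 1)) (x : N × ℝ) :
    fibrePrimitive η x = x.2 • ∫ σ in (0 : ℝ)..1,
      (((η (x.1, σ * x.2) : (EuclideanSpace ℝ (Fin m) × ℝ) [⋀^Fin (k + 1)]→L[ℝ] F)).curryLeft
        (((0 : EuclideanSpace ℝ (Fin m)), (1 : ℝ)) : EuclideanSpace ℝ (Fin m) × ℝ)).compContinuousLinearMap
        (linHom (vertQ m) σ) :=
  linHomOperator_inr_comp_snd _ _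

/-- The fibre primitive vanishes on the zero section. [folklore] -/
theorem fibrePrimitive_apply_zero (η : MForm ((𝓡 m).prod 𝓘(ℝ, ℝ)) (N × ℝ) F (k + 1)) (n : N) :
    fibrePrimitive η (n, 0) = 0 := by
  rw [fibrePrimitive_eq_smul]
  exact zero_smul ℝ _

/-! ### The product chart: coordinate changes are `τ × id`, constant along the fibres -/

section Chart

variable [IsManifold (𝓡 m) ∞ N]

/-- On the real line (model space of itself) all tangent coordinate changes are the identity.
[folklore] -/
theorem tangentCoordChange_real (a b c : ℝ) :
    tangentCoordChange 𝓘(ℝ, ℝ) a b c = ContinuousLinearMap.id ℝ ℝ := by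
  ext
  rw [tangentCoordChange_def]
  simp

/-- **Tangent coordinate changes of `N × ℝ` are `τ × id`**, `τ` the coordinate change of `N`;
in particular they do not depend on the `ℝ`-coordinate. [folklore] -/
theorem tangentCoordChange_prod_real {x₀ z : N × ℝ}
    (hz : z ∈ (extChartAt ((𝓡 m).prod 𝓘(ℝ, ℝ)) x₀).source) :
    tangentCoordChange ((𝓡 m).prod 𝓘(ℝ, ℝ)) x₀ z z =
      (tangentCoordChange (𝓡 m) x₀.1 z.1 z.1).prodMap (ContinuousLinearMap.id ℝ ℝ) := by
  rw [tangentCoordChange_prod ⟨hz, mem_extChartAt_source z⟩, tangentCoordChange_real]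

omit [IsManifold (𝓡 m) ∞ N] in
/-- The source of the product chart is `source × univ`. [folklore] -/
theorem mem_extChartAt_prod_real_source {x₀ z : N × ℝ} :
    z ∈ (extChartAt ((𝓡 m).prod 𝓘(ℝ, ℝ)) x₀).source ↔
      z.1 ∈ (extChartAt (𝓡 m) x₀.1).source := by
  rw [extChartAt_prod]
  simp

omit [IsManifold (𝓡 m) ∞ N] in
/-- The target of the product chart is `target × univ`. [folklore] -/
theorem mem_extChartAt_prod_real_target {x₀ : N × ℝ} {y : EuclideanSpace ℝ (Fin m) × ℝ} :
    y ∈ (extChartAt ((𝓡 m).prod 𝓘(ℝ, ℝ)) x₀).target ↔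
      y.1 ∈ (extChartAt (𝓡 m) x₀.1).target := by
  rw [extChartAt_prod]
  simp

omit [IsManifold (𝓡 m) ∞ N] in
/-- The inverse product chart is `φ⁻¹ × id`. [folklore] -/
theorem extChartAt_prod_real_symm_eq (x₀ : N × ℝ) (y : EuclideanSpace ℝ (Fin m) × ℝ) :
    (extChartAt ((𝓡 m).prod 𝓘(ℝ, ℝ)) x₀).symm y = ((extChartAt (𝓡 m) x₀.1).symm y.1, y.2) := by
  rw [extChartAt_prod]
  rfl

end Chart


/-! ### The fibre primitive read in a product chart is the flat operator of the representative -/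

section InChart

/-- Algebra of the integrands: conjugating by a coordinate change `τ × id` (which fixes the
vertical vector `(0, s)` and commutes with `H_σ`) passes through `ι_{(0,s)}` and `H_σ^*`.
[folklore] -/
theorem curryLeft_compContinuousLinearMap_prodMap
    (A : (EuclideanSpace ℝ (Fin m) × ℝ) [⋀^Fin (k + 1)]→L[ℝ] F)
    (τ : EuclideanSpace ℝ (Fin m) →L[ℝ] EuclideanSpace ℝ (Fin m)) (σ s : ℝ) :
    ((A.compContinuousLinearMap (τ.prodMap (ContinuousLinearMap.id ℝ ℝ))).curryLeft
        (((0 : EuclideanSpace ℝ (Fin m)), s) : EuclideanSpace ℝ (Fin m) × ℝ)).compContinuousLinearMap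
        (linHom (vertQ m) σ) =
      (((A.curryLeft (((0 : EuclideanSpace ℝ (Fin m)), s) : EuclideanSpace ℝ (Fin m) × ℝ))
        |>.compContinuousLinearMap (linHom (vertQ m) σ)).compContinuousLinearMap
          (τ.prodMap (ContinuousLinearMap.id ℝ ℝ))) := by
  ext v
  simp only [compContinuousLinearMap_apply, curryLeft_apply_apply, Function.comp_def]
  refine congrArg A (funext fun i ↦ Fin.cases ?_ (fun j ↦ ?_) i)
  · simp
  · simp only [Matrix.cons_val_succ]
    exact DFunLike.congr_fun (linHom_vertQ_comp_prodMap (m := m) σ τ).symm (v j)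

variable [IsManifold (𝓡 m) ∞ N] [CompleteSpace F]

/-- **In a product chart the fibre primitive IS the flat homotopy operator of the chart
representative**: for `y` in the target of the chart at `x₀`,
`(fibrePrimitive η).inChart x₀ y = linHomOperator (vertQ m) (η.inChart x₀) y`, provided the
integrand along the fibre of `y` is integrable (e.g. `η` continuous along it).  The coordinate
change `τ × id` of `N × ℝ` is the same at all points of a fibre, fixes `(0, s)` and commutes with
`H_σ`. [folklore] -/
theorem inChart_fibrePrimitive (η : MForm ((𝓡 m).prod 𝓘(ℝ, ℝ)) (N × ℝ) F (k + 1)) {x₀ : N × ℝ}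
    {y : EuclideanSpace ℝ (Fin m) × ℝ} (hy : y ∈ (extChartAt ((𝓡 m).prod 𝓘(ℝ, ℝ)) x₀).target)
    (hint : IntervalIntegrable (fun σ : ℝ ↦
      (((η ((extChartAt (𝓡 m) x₀.1).symm y.1, σ * y.2) :
          (EuclideanSpace ℝ (Fin m) × ℝ) [⋀^Fin (k + 1)]→L[ℝ] F)).curryLeft
        (((0 : EuclideanSpace ℝ (Fin m)), y.2) : EuclideanSpace ℝ (Fin m) × ℝ)).compContinuousLinearMap
        (linHom (vertQ m) σ)) volume 0 1) :
    (fibrePrimitive η).inChart x₀ y = linHomOperator (vertQ m) (η.inChart x₀) y := by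
  have hy1 : y.1 ∈ (extChartAt (𝓡 m) x₀.1).target := mem_extChartAt_prod_real_target.1 hy
  set n : N := (extChartAt (𝓡 m) x₀.1).symm y.1 with hn
  have hns : n ∈ (extChartAt (𝓡 m) x₀.1).source := (extChartAt (𝓡 m) x₀.1).map_target hy1
  -- the coordinate change at the points `(n, s)` of the fibre: `τ × id`, independent of `s`
  set τ := tangentCoordChange (𝓡 m) x₀.1 n n with hτ
  have hT : ∀ s : ℝ, tangentCoordChange ((𝓡 m).prod 𝓘(ℝ, ℝ)) x₀ ((n, s) : N × ℝ) (n, s) =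
      τ.prodMap (ContinuousLinearMap.id ℝ ℝ) := fun s ↦
    tangentCoordChange_prod_real (mem_extChartAt_prod_real_source.2 hns)
  have hsymm : ∀ s : ℝ, (extChartAt ((𝓡 m).prod 𝓘(ℝ, ℝ)) x₀).symm (y.1, s) = (n, s) := fun s ↦ by
    rw [extChartAt_prod_real_symm_eq]
  have hmem : ∀ s : ℝ, ((y.1, s) : EuclideanSpace ℝ (Fin m) × ℝ) ∈
      (extChartAt ((𝓡 m).prod 𝓘(ℝ, ℝ)) x₀).target := fun s ↦
    mem_extChartAt_prod_real_target.2 hy1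
  -- left-hand side
  have hy' : y = (y.1, y.2) := rfl
  rw [MForm.inChart_eq_of_mem_target _ hy]
  conv_lhs => rw [hy', hsymm y.2, hT y.2]
  rw [fibrePrimitive_apply]
  -- pass the coordinate change through the integral
  have hswap := ((ContinuousAlternatingMap.compContinuousLinearMapCLM (ι := Fin k) (F := F)
      (τ.prodMap (ContinuousLinearMap.id ℝ ℝ))).intervalIntegral_comp_comm hint).symm
  simp only [ContinuousAlternatingMap.compContinuousLinearMapCLM_apply] at hswap
  refine (Eq.trans (by rfl) hswap).trans ?_
  -- right-hand side, integrand by integrand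
  simp only [linHomOperator, linHomIntegrand, linHom_vertQ_apply, vertQ_apply]
  refine congrArg (fun f : ℝ → (EuclideanSpace ℝ (Fin m) × ℝ) [⋀^Fin k]→L[ℝ] F ↦
    ∫ σ in (0 : ℝ)..1, f σ) (funext fun σ ↦ ?_)
  rw [MForm.inChart_eq_of_mem_target _ (hmem (σ * y.2)), hsymm, hT]
  exact (curryLeft_compContinuousLinearMap_prodMap (η (n, σ * y.2)) τ σ y.2).symm

end InChart

end Literature.Geometry.Kaehler

end
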